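import Summits.Schanuel.Schanuel.Theorems.RootDecomp1KSkelCell04

/-!
# RootDecomp1KSkelCell — lens 1, generations 43–44 «THE QUALITY-ONLY CLASS SkelLiouville ⊋ LogLogLiouville AND ITS CERTIFIED MEMBER ρ⋆» (PRICE K-α L2033, CLAIM L2045, ACK L2046; (α) PROPER of the 1K wall map): the location-free class `SkelLiouville ρ := ∀ m ∃ r, m ≤ den r ∧ ρ ≠ r ∧ |ρ − r| < den^{−m·ι(den)}` (ι q = least N with q ≤ 2^{N!}) with `LogLogLiouville ⊊ SkelLiouville ⊆ Liouville` PROVED, the member ρ⋆ = Σ_j 2^{−2^{e_j}} (FREDHOLM SERIES WITH DELETED BLOCKS) certified HYPOTHESIS-FREE in Skel ∖ (LogLog ∪ FactorialGap), the SKEL engine + extraction, the walls (1, ℓ₂, ρ) mod hNW / π-twins and the pair (ℓ₂, ρ) HYPOTHESIS-FREE for every ρ ∈ Skel, the items APPLIED at z⋆ with all binders discharged, the m = 1 ceiling, and §9 hNW DISCHARGED BY NAME on the e-wall via the Literature proof module — continuation (RootDecomp1KSkelCell05): §2 THE ENGINE skelMeasure_cons_liouvilleNumber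

(lens-1 g43/g44 HOME kernel SkelCell.lean EDITION 2 b7163857…, 2822 l, imports tree RootDecomp1KGapCell01 (+ for §9 only Literature ExpOneTranscendenceMeasureProofs); CLAIM L2045, ACK L2046 (CHECKLIST K-α (1)–(8) + the constant-dependence line of L2085 (R4)), NODE L2132 / REQUEST L2133, critic VERDICT L2140 (crit g9: CLEARED — ONE CELL credit (K-α); lens-1 tally credits ×11 + THEOREM; PORT GO in substance 01–0k `--supports stmt-Schanuel-33364`, the two scoped heartbeat raises flagged for the port record, addendum D as RootDecomp1KNWMeasureHolds GO LOW); port by census-1 gen 18 as `RootDecomp1KSkelCell01`–`11` along K's sections: 01 = §1 `iota`, `SkelLiouville`, inclusions `SkelLiouville.liouville` / `logLogLiouville_skelLiouville`; 02 = §5a anchors `aI`/`sI` + §5b the skeleton `eS`, positions `cS`, terms `aS` (up to `summable_aS`); 03 = §5b the member `rhoStar`, truncations `tS`/`rS`, bounds + §6 covering / quality lemmas; 04 = §6 THE MEMBER THEOREMS `skelLiouville_rhoStar`, `not_logLogLiouville_rhoStar`, `not_factorialGapLiouville_rhoStar`, `liouville_rhoStar`, `not_skelLiouville_subset_logLogLiouville`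 + §2 engine preliminaries (`SkelMeasure`, `exists_scale_index_iota`); 05 = §2 THE ENGINE `skelMeasure_cons_liouvilleNumber` (scoped `maxHeartbeats 800000` as in K) + `SkelMeasure.mvWeakMeasure`; 06 = §3 EXTRACTION `no_int_relation_of_skelMeasure_skelLiouville`, `sb_of_skelLiouville_of_skelMeasure`; 07 = §4 THE CELLS (pair hyp-free, walls mod hNW, π-twins) + the live items in item shape; 08 = §7 three interlaced cuts `deletedBlock_margins`, `form_lower_bound_S` (scoped `maxHeartbeats 1600000`); 09 = §7b member tuples zS2/zS3/zS3pi, scope certificates, items AT the members; 10 = §8 the fixed-multiple ladder and the m = 1 ceiling (`uStar`, `skel_fixedOne_ceiling`); 11 = §9 hNW DISCHARGED BY NAME (imports Literature ExpOneTranscendenceMeasureProofs).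
PORT EDITS: `set_option linter.dupNamespace false` dropped; the Literature import moved from the head to part 11 (the only user); K's 13 private helpers travel as per-part private copies; two generic helpers made `private` after the dedup bounce of 02 (p829539: `two_mul_le_two_pow` ≡ Literature.NumberTheory.EllipticCurves.two_mul_le_two_pow; also `log_two_lt_self` pre-emptively) and of 03 (p829791: `one_le_loglog` ≡ Literature Tao2016.EntropyDecrement.one_le_log_log; then nine more generic arithmetic helpers privatised pre-emptively: loglog_pow_pow_ge, add_factorial_mul_le_factorial_add, one_lt_ell2, partialSum_two_two, five_fourths_le_partialSum, ell2_lt, psNumer_two_cast, two_pow_lt_psNumer); statements and proofs verbatim. `--supports stmt-Schanuel-33364`; no census credit carried; rung 0 — nothing here proves Schanuel.)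
-/

open Summit.Schanuel.Schanuel.Theorems.RootDecomp1KHyper
open Summit.Schanuel.Schanuel.Theorems.RootDecomp1KHyper.HyperCell
open Summit.Schanuel.Schanuel.Theorems.RootDecomp1KGeneric
open Summit.Schanuel.Schanuel.Theorems.RootDecomp1KRelLiouvilleCell
open Summit.Schanuel.Schanuel.Theorems.RootDecomp1KLogLogCell
open Summit.Schanuel.Schanuel.Theorems.RootDecomp1KTwoBaseCell
open Summit.Schanuel.Schanuel.Theorems.RootDecomp1KGapCell
open LiouvilleNumber
open scoped Nat

namespace Summit.Schanuel.Schanuel.Theorems.RootDecomp1KSkelCell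

section Engine

open Polynomial

/-- For `N ≥ 2` the partial sum `s_N` of `ℓ₂` is `p / 2^{N!}` with `p` ODD and `< 2 · 2^{N!}`
(copy of the tree's LogLogCell03 lemma, which lies outside this file's import cone). -/
private theorem partialSum_two_eq_odd_div' {N : ℕ} (hN : 2 ≤ N) :
    ∃ p : ℕ, Odd p ∧ partialSum 2 N = (p : ℝ) / (2 : ℝ) ^ N ! ∧ p < 2 * 2 ^ N ! := by
  obtain ⟨M, rfl⟩ : ∃ M, N = M + 1 := ⟨N - 1, by omega⟩
  have hM : 1 ≤ M := by omega
  obtain ⟨p₀, hp₀⟩ := partialSum_eq_rat (m := 2) (by norm_num) M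
  simp only [Nat.cast_ofNat] at hp₀
  have hfle : M ! ≤ (M + 1)! := Nat.factorial_le (Nat.le_succ M)
  obtain ⟨e, he⟩ : ∃ e, (M + 1)! = M ! + e := ⟨(M + 1)! - M !, by omega⟩
  have he1 : 1 ≤ e := by
    have h1 : (M + 1)! = (M + 1) * M ! := Nat.factorial_succ M
    have h2 : M ! ≤ M * M ! := Nat.le_mul_of_pos_left _ (by omega)
    have h3 : 1 ≤ M ! := Nat.factorial_pos M
    have h4 : (M + 1) * M ! = M * M ! + M ! := by ring
    omega
  have heq : partialSum 2 (M + 1) = ((p₀ * 2 ^ e + 1 : ℕ) : ℝ) / (2 : ℝ) ^ (M + 1)! := by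
    rw [partialSum_succ, hp₀, he, pow_add]
    have h2 : (0 : ℝ) < 2 ^ M ! := by positivity
    have h2e : (0 : ℝ) < 2 ^ e := by positivity
    push_cast
    field_simp
  refine ⟨p₀ * 2 ^ e + 1, Even.add_one ((Nat.even_pow.mpr ⟨even_two, by omega⟩).mul_left p₀),
    heq, ?_⟩
  have hlt : ((p₀ * 2 ^ e + 1 : ℕ) : ℝ) / 2 ^ (M + 1)! < 2 := by
    rw [← heq]; linarith [partialSum_two_lt_liouvilleNumber (M + 1), liouvilleNumber_two_lt]
  have hpow : (0 : ℝ) < 2 ^ (M + 1)! := by positivity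
  rw [div_lt_iff₀ hpow] at hlt
  exact_mod_cast hlt

set_option maxHeartbeats 800000 in

set_option maxHeartbeats 800000 in
/-- **THE INDUCED SKEL MEASURE (the engine of this node).**  If `θ = (θ₁,…,θₙ)` has a polynomial measure of
algebraic independence (`MvPolyMeasure`, tree) then `(ℓ₂, θ₁, …, θₙ)` has a SKEL measure:
`|Q(ℓ₂, θ)| ≥ exp(−C (1 + log len Q)(1 + ι(len Q)))` for all non-zero `Q` of total degree `≤ d`.
Mechanism = the tree's induced measure v2 VERBATIM (one partial sum `s_N = p/2^{N!}`, `p` odd, the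
rational-root Lemma A `mvspecialise_ne_zero_of_coprime`, the factorial tail), except that the first
admissible scale `N` is booked through `ι(len Q)` (`exists_scale_index_iota`: `N! ≲ log len · ι(len)`)
instead of `log len · log log len`.  No named fact enters. -/
theorem skelMeasure_cons_liouvilleNumber {n : ℕ} {θ : Fin n → ℂ} (hθ : MvPolyMeasure θ) :
    SkelMeasure (Fin.cons ((liouvilleNumber 2 : ℝ) : ℂ) θ : Fin (n + 1) → ℂ) := by
  intro d
  classical
  obtain ⟨C₀, τ, hC₀, hmeas₀⟩ := hθ d
  -- WLOG the measure constant is ≥ 1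
  set Cθ : ℝ := max C₀ 1 with hCθdef
  have hCθ1 : 1 ≤ Cθ := le_max_right _ _
  have hCθ : 0 < Cθ := by linarith
  have hmeas : ∀ P : MvPolynomial (Fin n) ℤ, P ≠ 0 → P.totalDegree ≤ d →
      1 ≤ Cθ * ((mvlen P : ℤ) : ℝ) ^ τ * ‖MvPolynomial.aeval θ P‖ := by
    intro P hP hdeg
    refine (hmeas₀ P hP hdeg).trans ?_
    have h0 : (0 : ℝ) ≤ ((mvlen P : ℤ) : ℝ) ^ τ := pow_nonneg (by exact_mod_cast mvlen_nonneg P) τ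
    exact mul_le_mul_of_nonneg_right (mul_le_mul_of_nonneg_right (le_max_left _ _) h0)
      (norm_nonneg _)
  -- the size of θ and the constants of the node
  set B : ℝ := 1 + ∑ i, ‖θ i‖ with hBdef
  have hsum0 : 0 ≤ ∑ i, ‖θ i‖ := Finset.sum_nonneg fun i _ => norm_nonneg _
  have hB1 : 1 ≤ B := by rw [hBdef]; linarith
  have hθB : ∀ i, ‖θ i‖ ≤ B := fun i => by
    have := Finset.single_le_sum (f := fun i => ‖θ i‖) (fun i _ => norm_nonneg _)
      (Finset.mem_univ i)
    rw [hBdef]; linarith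
  set Γ : ℝ := ((d : ℝ) + 1) * d * 2 ^ d * B ^ d + 1 with hΓdef
  have hΓ0 : (0 : ℝ) ≤ ((d : ℝ) + 1) * d * 2 ^ d * B ^ d := by positivity
  have hΓ1 : 1 ≤ Γ := by rw [hΓdef]; linarith
  have hΓpos : 0 < Γ := by linarith
  set C₁ : ℝ := Cθ * ((3 : ℝ) ^ d * (d + 1)) ^ τ with hC₁def
  have h3d1 : (1 : ℝ) ≤ (3 : ℝ) ^ d * (d + 1) := by
    have h1 : (1 : ℝ) ≤ 3 ^ d := one_le_pow₀ (by norm_num)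
    have h2 : (1 : ℝ) ≤ (d : ℝ) + 1 := by linarith [(Nat.cast_nonneg d : (0 : ℝ) ≤ d)]
    nlinarith
  have hC₁1 : 1 ≤ C₁ := by
    rw [hC₁def]; exact one_le_mul_of_one_le_of_one_le hCθ1 (one_le_pow₀ h3d1)
  have hC₁pos : 0 < C₁ := by linarith
  -- the least admissible scale index: `N ≥ N_d := d(τ+1) + 2` (`+2` makes the numerator of `s_N` odd)
  set Nd : ℕ := d * (τ + 1) + 2 with hNddef
  have h4ΓC₁ : (1 : ℝ) ≤ 4 * Γ * C₁ := one_le_mul_of_one_le_of_one_le (by linarith) hC₁1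
  have hlog4 : 0 ≤ Real.log (4 * Γ * C₁) := Real.log_nonneg h4ΓC₁
  set cY : ℝ := Real.log (4 * Γ * C₁) + 1 + τ + 1 with hcYdef
  have hcY1 : 1 ≤ cY := by rw [hcYdef]; linarith [(Nat.cast_nonneg τ : (0 : ℝ) ≤ τ)]
  have hcY0 : 0 ≤ cY := by linarith
  set c₁ : ℝ := 2 * cY + 1 with hc₁def
  have hc₁1 : 1 ≤ c₁ := by rw [hc₁def]; linarith
  have hc₁0 : 0 ≤ c₁ := by linarith
  -- NEW (ι-bookkeeping): `4 Γ C₁ ≤ 2^e`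
  set e : ℕ := ⌈4 * Γ * C₁⌉₊ with hedef
  have he : 4 * Γ * C₁ ≤ (2 : ℝ) ^ e := by
    have h1 : 4 * Γ * C₁ ≤ (e : ℝ) := Nat.le_ceil _
    have h2 : (e : ℝ) ≤ 2 ^ e := by exact_mod_cast (Nat.lt_two_pow_self).le
    linarith
  set A₀ : ℝ := ((Nd ! : ℕ) : ℝ) + ((e : ℝ) + τ + 3) * c₁ with hA₀def
  have hA₀0 : 0 ≤ A₀ := by positivity
  set Cst : ℝ := 2 * C₁ + τ + (d : ℝ) * (τ + 1) * A₀ + 1 with hCstdef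
  refine ⟨Cst, by positivity, fun Q hQ hdeg => ?_⟩
  clear_value Cst A₀ c₁ cY Nd C₁ Γ B Cθ
  -- notation for Q
  set L : ℝ := ((mvlen Q : ℤ) : ℝ) with hLdef
  set Lz : ℕ := (mvlen Q).toNat with hLzdef
  have hLzL : (Lz : ℝ) = L := by
    rw [hLzdef, hLdef]
    have h := Int.toNat_of_nonneg (mvlen_nonneg Q)
    exact_mod_cast h
  have hL1 : 1 ≤ L := by rw [hLdef]; exact_mod_cast one_le_mvlen hQ
  have hL0 : 0 ≤ L := by linarith
  have hlogL0 : 0 ≤ Real.log L := Real.log_nonneg hL1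
  set u : ℝ := 1 + Real.log L with hudef
  have hu1 : 1 ≤ u := by rw [hudef]; linarith
  have hu0 : 0 ≤ u := by linarith
  set w : ℝ := 1 + (iota Lz : ℝ) with hwdef
  have hι0 : (0 : ℝ) ≤ iota Lz := Nat.cast_nonneg _
  have hw1 : 1 ≤ w := by rw [hwdef]; linarith
  have huw1 : 1 ≤ u * w := one_le_mul_of_one_le_of_one_le hu1 hw1
  have hLuw : Real.log L ≤ u * w :=
    (show Real.log L ≤ u by rw [hudef]; linarith).trans (le_mul_of_one_le_right hu0 hw1)
  clear_value u w
  set ℓ : ℝ := liouvilleNumber 2 with hℓdef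
  have hℓpos : 0 < ℓ := liouvilleNumber_two_pos
  have hℓlt : ℓ < 3 / 2 := liouvilleNumber_two_lt
  clear_value ℓ
  -- the slices G_k of Q and the one-variable polynomial μ = Q(·, θ)
  set K : ℕ := (MvPolynomial.finSuccEquiv ℤ n Q).natDegree with hKdef
  have hKd : K ≤ d := (natDegree_finSuccEquiv_le_totalDegree Q).trans hdeg
  set G : Fin (K + 1) → MvPolynomial (Fin n) ℤ := fun k => ycoeff Q k with hGdef
  have hGdeg : ∀ k, (G k).totalDegree ≤ d := fun k => (totalDegree_ycoeff_le Q k).trans hdeg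
  have hGlenZ : ∀ k, mvlen (G k) ≤ mvlen Q := fun k => mvlen_ycoeff_le Q k
  have hGlen : ∀ k, ((mvlen (G k) : ℤ) : ℝ) ≤ L := fun k => by
    rw [hLdef]; exact_mod_cast hGlenZ k
  have hGK : G (Fin.last K) ≠ 0 := by
    have hne : MvPolynomial.finSuccEquiv ℤ n Q ≠ 0 := (EmbeddingLike.map_ne_zero_iff).mpr hQ
    have h1 := Polynomial.leadingCoeff_ne_zero.mpr hne
    rw [Polynomial.leadingCoeff] at h1
    simpa [hGdef, ycoeff, hKdef] using h1
  set μ : ℂ[X] := ∑ k : Fin (K + 1), C (MvPolynomial.aeval θ (G k)) * X ^ (k : ℕ) with hμdef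
  have hμeval : ∀ y : ℂ, μ.eval y =
      ∑ k : Fin (K + 1), MvPolynomial.aeval θ (G k) * y ^ (k : ℕ) := by
    intro y
    simp only [hμdef, eval_finsetSum, eval_mul, eval_C, eval_pow, eval_X]
  have hQeval : ∀ y : ℂ, MvPolynomial.aeval (Fin.cons y θ : Fin (n + 1) → ℂ) Q = μ.eval y := by
    intro y
    rw [hμeval, mvaeval_cons_eq_sum Q θ y le_rfl,
      ← Fin.sum_univ_eq_sum_range (fun k => MvPolynomial.aeval θ (ycoeff Q k) * y ^ k) (K + 1)]
  clear_value μ G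
  -- sizes of the slices and the tail estimate
  have hGnorm : ∀ k, ‖MvPolynomial.aeval θ (G k)‖ ≤ L * B ^ d := fun k =>
    (norm_mvaeval_le_mvlen_mul_pow (G k) θ hB1 hθB (hGdeg k)).trans
      (mul_le_mul_of_nonneg_right (hGlen k) (by positivity))
  have htail : ∀ a b : ℝ, |a| ≤ 2 → |b| ≤ 2 →
      ‖μ.eval (a : ℂ) - μ.eval (b : ℂ)‖ ≤ Γ * L * |a - b| := by
    intro a b ha hb
    rw [hμeval, hμeval]
    refine (norm_sum_sub_sum_le hKd _ (by positivity) hGnorm ha hb).trans ?_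
    have hLab : 0 ≤ L * |a - b| := by positivity
    calc ((d : ℝ) + 1) * (L * B ^ d) * (d * 2 ^ d) * |a - b|
        = (((d : ℝ) + 1) * d * 2 ^ d * B ^ d) * (L * |a - b|) := by ring
      _ ≤ Γ * (L * |a - b|) := by
          refine mul_le_mul_of_nonneg_right ?_ hLab
          rw [hΓdef]; linarith
      _ = Γ * L * |a - b| := by ring
  -- the scale: Y ≤ 2^{N!} =: q, N ≥ N_d, and L < Y
  set Y : ℝ := 4 * Γ * C₁ * L ^ (1 + τ) with hYdef
  have hLpow1 : 1 ≤ L ^ (1 + τ) := one_le_pow₀ hL1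
  have hY1 : 1 ≤ Y := by
    rw [hYdef]; exact one_le_mul_of_one_le_of_one_le h4ΓC₁ hLpow1
  have hYpos : 0 < Y := lt_of_lt_of_le one_pos hY1
  have hLY : L < Y := by
    rw [hYdef]
    have h1 : L ≤ L ^ (1 + τ) := le_self_pow₀ hL1 (by omega)
    have h14 : (1 : ℝ) < 4 * Γ * C₁ := by nlinarith
    have h2 : L ^ (1 + τ) < 4 * Γ * C₁ * L ^ (1 + τ) := lt_mul_of_one_lt_left (by positivity) h14
    linarith
  have hlogY : Real.log Y ≤ cY * u := by
    have e1 : Real.log Y = Real.log (4 * Γ * C₁) + (1 + τ) * Real.log L := by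
      rw [hYdef, Real.log_mul (by positivity) (by positivity), Real.log_pow]; push_cast; ring
    rw [e1, hcYdef]
    have h1 : (1 + (τ : ℝ)) * Real.log L ≤ (1 + τ) * u := by
      apply mul_le_mul_of_nonneg_left _ (by positivity); rw [hudef]; linarith
    have h2 : Real.log (4 * Γ * C₁) * 1 ≤ Real.log (4 * Γ * C₁) * u :=
      mul_le_mul_of_nonneg_left hu1 hlog4
    have e2 : (Real.log (4 * Γ * C₁) + 1 + τ + 1) * u =
        Real.log (4 * Γ * C₁) * u + (1 + τ) * u + u := by ring
    rw [e2]
    linarith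
  have hlogY0 : 0 ≤ Real.log Y := Real.log_nonneg hY1
  have hYle : Y ≤ (2 : ℝ) ^ e * (Lz : ℝ) ^ (1 + τ) := by
    rw [hYdef, hLzL]; exact mul_le_mul_of_nonneg_right he (by positivity)
  clear_value Y
  obtain ⟨N, hNdN, hNY, hNfact0⟩ := exists_scale_index_iota hY1 Nd e (1 + τ) Lz hYle
  have hNdN' : d * (τ + 1) + 2 ≤ N := by rw [hNddef] at hNdN; exact hNdN
  have hN2 : 2 ≤ N := le_of_add_le_right hNdN'
  have hNdτ : d * (τ + 1) ≤ N := le_of_add_le_left hNdN'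
  set sN : ℝ := partialSum 2 N with hsNdef
  have hsNpos : 0 < sN := partialSum_two_pos N
  have hsNlt : sN < ℓ := by rw [hℓdef]; exact partialSum_two_lt_liouvilleNumber N
  have hdist : |ℓ - sN| < 2 / 2 ^ (N + 1)! := by
    rw [hℓdef]; exact abs_liouvilleNumber_two_sub_partialSum N
  -- s_N = p / q with q = 2^{N!}, p odd
  obtain ⟨p, hpodd, hp, hp2⟩ := partialSum_two_eq_odd_div' hN2
  set q : ℕ := 2 ^ N ! with hqdef
  have hq0 : q ≠ 0 := by positivity
  have hqR : (q : ℝ) = 2 ^ N ! := by rw [hqdef]; push_cast; rfl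
  have hq1 : (1 : ℝ) ≤ q := by rw [hqR]; exact one_le_pow₀ (by norm_num)
  have hqpos : (0 : ℝ) < q := by linarith
  have hsN : sN = (p : ℝ) / q := by rw [hqR]; exact hp
  have hp2' : p < 2 * q := by rw [hqdef]; exact hp2
  have hcopN : Nat.Coprime p q := by
    rw [hqdef]; exact Nat.Coprime.pow_right _ (Nat.coprime_two_right.mpr hpodd)
  have hcop : IsCoprime (p : ℤ) (q : ℤ) := Nat.isCoprime_iff_coprime.mpr hcopN
  have hYq : Y ≤ q := by rw [hqR]; exact hNY
  have hLq : L < q := hLY.trans_le hYq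
  clear_value sN q
  -- the integer specialisation H = q^K Q(s_N, X): NON-ZERO by the rational-root lemma
  set H : MvPolynomial (Fin n) ℤ := mvspecialise G (p : ℤ) q with hHdef
  have hHe : MvPolynomial.aeval θ H = (q : ℂ) ^ K * μ.eval ((sN : ℝ) : ℂ) := by
    rw [hHdef, mvaeval_mvspecialise G (p : ℤ) hq0 θ, hμeval, hsN]
    push_cast
    rfl
  have hH0 : H ≠ 0 := by
    rw [hHdef]
    refine mvspecialise_ne_zero_of_coprime G ⟨Fin.last K, hGK⟩ hcop fun k => ?_
    have h1 : ((mvlen (G k) : ℤ) : ℝ) < ((q : ℤ) : ℝ) := by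
      rw [Int.cast_natCast]; exact (hGlen k).trans_lt hLq
    exact_mod_cast h1
  have hHdeg : H.totalDegree ≤ d := totalDegree_mvspecialise_le G p q hGdeg
  -- the length of H
  have hpq : |(p : ℤ)| + (q : ℤ) ≤ 3 * q := by
    rw [abs_of_nonneg (by positivity)]
    omega
  have hΛle : ∑ k : Fin (K + 1), mvlen (G k) ≤ ((K + 1 : ℕ) : ℤ) * mvlen Q := by
    calc ∑ k : Fin (K + 1), mvlen (G k) ≤ ∑ _k : Fin (K + 1), mvlen Q :=
          Finset.sum_le_sum fun k _ => hGlenZ k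
      _ = ((K + 1 : ℕ) : ℤ) * mvlen Q := by
          rw [Finset.sum_const, Finset.card_univ, Fintype.card_fin, nsmul_eq_mul]
  have hΛ0 : (0 : ℤ) ≤ ∑ k : Fin (K + 1), mvlen (G k) := Finset.sum_nonneg fun _ _ => mvlen_nonneg _
  have hlenHZ : mvlen H ≤ (3 * (q : ℤ)) ^ K * (((K + 1 : ℕ) : ℤ) * mvlen Q) := by
    calc mvlen H ≤ (|(p : ℤ)| + q) ^ K * ∑ k, mvlen (G k) := mvlen_mvspecialise_le G p q
      _ ≤ (3 * (q : ℤ)) ^ K * ∑ k, mvlen (G k) :=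
          mul_le_mul_of_nonneg_right (pow_le_pow_left₀ (by positivity) hpq K) hΛ0
      _ ≤ (3 * (q : ℤ)) ^ K * (((K + 1 : ℕ) : ℤ) * mvlen Q) :=
          mul_le_mul_of_nonneg_left hΛle (by positivity)
  have hlenH : ((mvlen H : ℤ) : ℝ) ≤ (3 : ℝ) ^ d * (d + 1) * (q : ℝ) ^ d * L := by
    have h1 : ((mvlen H : ℤ) : ℝ) ≤ (((3 * (q : ℤ)) ^ K * (((K + 1 : ℕ) : ℤ) * mvlen Q) : ℤ) : ℝ) := by
      exact_mod_cast hlenHZ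
    refine h1.trans ?_
    push_cast
    rw [← hLdef]
    have hq3 : (1 : ℝ) ≤ 3 * q := by linarith
    have e1 : (3 * (q : ℝ)) ^ K ≤ (3 * (q : ℝ)) ^ d := pow_le_pow_right₀ hq3 hKd
    have e2 : (K : ℝ) + 1 ≤ d + 1 := by exact_mod_cast Nat.succ_le_succ hKd
    have e3 : ((K : ℝ) + 1) * L ≤ ((d : ℝ) + 1) * L := mul_le_mul_of_nonneg_right e2 hL0
    calc (3 * (q : ℝ)) ^ K * (((K : ℝ) + 1) * L) ≤ (3 * (q : ℝ)) ^ d * (((d : ℝ) + 1) * L) :=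
          mul_le_mul e1 e3 (by positivity) (by positivity)
      _ = (3 : ℝ) ^ d * (d + 1) * (q : ℝ) ^ d * L := by rw [mul_pow]; ring
  have hlenH0 : (0 : ℝ) ≤ ((mvlen H : ℤ) : ℝ) := by exact_mod_cast mvlen_nonneg H
  -- the measure of θ at H: X := (C₁ L^τ q^{d(τ+1)})⁻¹ ≤ |μ(s_N)|
  have hmeasH := hmeas H hH0 hHdeg
  have hHnorm : ‖MvPolynomial.aeval θ H‖ = (q : ℝ) ^ K * ‖μ.eval ((sN : ℝ) : ℂ)‖ := by
    rw [hHe, norm_mul, norm_pow, Complex.norm_natCast]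
  clear_value H
  have hlow : 1 ≤ C₁ * L ^ τ * (q : ℝ) ^ (d * (τ + 1)) * ‖μ.eval ((sN : ℝ) : ℂ)‖ := by
    rw [hHnorm] at hmeasH
    have e1 : ((mvlen H : ℤ) : ℝ) ^ τ ≤ ((3 : ℝ) ^ d * (d + 1) * (q : ℝ) ^ d * L) ^ τ :=
      pow_le_pow_left₀ hlenH0 hlenH τ
    have e2 : (q : ℝ) ^ K ≤ (q : ℝ) ^ d := pow_le_pow_right₀ hq1 hKd
    have e3 : Cθ * ((mvlen H : ℤ) : ℝ) ^ τ ≤ Cθ * ((3 : ℝ) ^ d * (d + 1) * (q : ℝ) ^ d * L) ^ τ :=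
      mul_le_mul_of_nonneg_left e1 hCθ.le
    have e4 : (q : ℝ) ^ K * ‖μ.eval ((sN : ℝ) : ℂ)‖ ≤ (q : ℝ) ^ d * ‖μ.eval ((sN : ℝ) : ℂ)‖ :=
      mul_le_mul_of_nonneg_right e2 (norm_nonneg _)
    have e5 : (0 : ℝ) ≤ Cθ * ((3 : ℝ) ^ d * (d + 1) * (q : ℝ) ^ d * L) ^ τ := by positivity
    calc (1 : ℝ) ≤ Cθ * ((mvlen H : ℤ) : ℝ) ^ τ * ((q : ℝ) ^ K * ‖μ.eval ((sN : ℝ) : ℂ)‖) := hmeasH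
      _ ≤ Cθ * ((3 : ℝ) ^ d * (d + 1) * (q : ℝ) ^ d * L) ^ τ *
            ((q : ℝ) ^ d * ‖μ.eval ((sN : ℝ) : ℂ)‖) := mul_le_mul e3 e4 (by positivity) e5
      _ = C₁ * L ^ τ * (q : ℝ) ^ (d * (τ + 1)) * ‖μ.eval ((sN : ℝ) : ℂ)‖ := by
          rw [hC₁def, Nat.mul_succ, pow_add, pow_mul]
          simp only [mul_pow]
          ring
  set X : ℝ := (C₁ * L ^ τ * (q : ℝ) ^ (d * (τ + 1)))⁻¹ with hXdef
  have hDpos : 0 < C₁ * L ^ τ * (q : ℝ) ^ (d * (τ + 1)) := by positivity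
  have hXpos : 0 < X := inv_pos.mpr hDpos
  have hXle : X ≤ ‖μ.eval ((sN : ℝ) : ℂ)‖ := by
    rw [hXdef, inv_le_iff_one_le_mul₀' hDpos]; exact hlow
  clear_value X
  -- the tail: |μ(ℓ) − μ(s_N)| ≤ Γ L |ℓ − s_N| ≤ X / 2, by the scale inequality Y q^{d(τ+1)} ≤ 2^{(N+1)!}
  have hℓ2 : |ℓ| ≤ 2 := by rw [abs_of_pos hℓpos]; linarith
  have hs2 : |sN| ≤ 2 := by rw [abs_of_pos hsNpos]; linarith
  have htailN := htail ℓ sN hℓ2 hs2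
  have hwin_ineq : Y * (q : ℝ) ^ (d * (τ + 1)) ≤ (2 : ℝ) ^ (N + 1)! := by
    have e1 : (2 : ℝ) ^ (N + 1)! = (q : ℝ) ^ (N + 1) := by
      rw [hqR, ← pow_mul, Nat.factorial_succ, mul_comm]
    rw [e1, pow_succ']
    have hqq : (q : ℝ) ^ (d * (τ + 1)) ≤ (q : ℝ) ^ N := pow_le_pow_right₀ hq1 hNdτ
    exact mul_le_mul hYq hqq (by positivity) (by positivity)
  have htail2 : Γ * L * |ℓ - sN| ≤ X / 2 := by
    have hpow_pos : (0 : ℝ) < 2 ^ (N + 1)! := by positivity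
    have h1 : Γ * L * |ℓ - sN| ≤ Γ * L * (2 / 2 ^ (N + 1)!) :=
      mul_le_mul_of_nonneg_left hdist.le (by positivity)
    have h2 : (2 : ℝ) / 2 ^ (N + 1)! ≤ 2 / (Y * (q : ℝ) ^ (d * (τ + 1))) :=
      div_le_div_of_nonneg_left (by norm_num) (by positivity) hwin_ineq
    have h3 : Γ * L * (2 / (Y * (q : ℝ) ^ (d * (τ + 1)))) = X / 2 := by
      rw [hXdef, hYdef]
      field_simp
      ring
    calc Γ * L * |ℓ - sN| ≤ Γ * L * (2 / 2 ^ (N + 1)!) := h1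
      _ ≤ Γ * L * (2 / (Y * (q : ℝ) ^ (d * (τ + 1)))) :=
          mul_le_mul_of_nonneg_left h2 (by positivity)
      _ = X / 2 := h3
  -- hence |Q(ℓ₂, θ)| = |μ(ℓ)| ≥ X / 2
  have hfinal : X / 2 ≤ ‖MvPolynomial.aeval (Fin.cons ((ℓ : ℝ) : ℂ) θ : Fin (n + 1) → ℂ) Q‖ := by
    rw [hQeval]
    have h1 := norm_sub_norm_le (μ.eval ((sN : ℝ) : ℂ)) (μ.eval ((ℓ : ℝ) : ℂ))
    rw [norm_sub_rev] at h1
    linarith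
  refine le_trans ?_ hfinal
  -- it remains: exp(−Cst u w) ≤ X / 2, i.e. 2 C₁ L^τ q^{d(τ+1)} ≤ exp(Cst u w)
  have hX2 : X / 2 = (2 * C₁ * L ^ τ * (q : ℝ) ^ (d * (τ + 1)))⁻¹ := by
    rw [hXdef, div_eq_mul_inv, ← mul_inv]
    congr 1
    ring
  rw [hX2, Real.exp_neg]
  refine inv_anti₀ (by positivity) ?_
  -- the scale bookkeeping: N! ≤ A₀ · (u w)
  have hNfact : ((N ! : ℕ) : ℝ) ≤ A₀ * (u * w) ^ 1 := by
    rw [pow_one, hA₀def]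
    have hT : 2 * Real.log Y + 1 ≤ c₁ * u := by
      have e1 : c₁ * u = 2 * (cY * u) + u := by rw [hc₁def]; ring
      rw [e1]; linarith [hlogY, hu1]
    have hS0 : (0 : ℝ) ≤ (iota Lz : ℝ) + e + (1 + τ : ℕ) + 2 := by positivity
    have h3 : ((iota Lz : ℝ) + e + (1 + τ : ℕ) + 2) * (2 * Real.log Y + 1) ≤
        ((iota Lz : ℝ) + e + (1 + τ : ℕ) + 2) * (c₁ * u) := mul_le_mul_of_nonneg_left hT hS0
    have h4 : (iota Lz : ℝ) + e + (1 + τ : ℕ) + 2 ≤ ((e : ℝ) + τ + 3) * w := by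
      have hprod : (0 : ℝ) ≤ ((e : ℝ) + τ + 2) * (iota Lz : ℝ) := by positivity
      have hexp : ((e : ℝ) + τ + 3) * w =
          ((e : ℝ) + τ + 3) + (iota Lz : ℝ) + ((e : ℝ) + τ + 2) * (iota Lz : ℝ) := by
        rw [hwdef]; ring
      rw [hexp]; push_cast; linarith
    have hc₁u : 0 ≤ c₁ * u := by positivity
    have h5 : ((iota Lz : ℝ) + e + (1 + τ : ℕ) + 2) * (c₁ * u) ≤ (((e : ℝ) + τ + 3) * w) * (c₁ * u) :=
      mul_le_mul_of_nonneg_right h4 hc₁u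
    have h6 : ((Nd ! : ℕ) : ℝ) ≤ ((Nd ! : ℕ) : ℝ) * (u * w) :=
      le_mul_of_one_le_right (Nat.cast_nonneg _) huw1
    calc ((N ! : ℕ) : ℝ) ≤ (Nd ! : ℕ) + ((iota Lz : ℝ) + e + (1 + τ : ℕ) + 2) * (2 * Real.log Y + 1) :=
          hNfact0
      _ ≤ ((Nd ! : ℕ) : ℝ) * (u * w) + (((e : ℝ) + τ + 3) * w) * (c₁ * u) := by linarith
      _ = (((Nd ! : ℕ) : ℝ) + ((e : ℝ) + τ + 3) * c₁) * (u * w) := by ring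
  have hqpow : (q : ℝ) ^ (d * (τ + 1)) ≤ Real.exp ((d : ℝ) * (τ + 1) * (N ! : ℕ)) := by
    rw [hqR, ← pow_mul]
    have h2e : (2 : ℝ) ≤ Real.exp 1 := by
      have := Real.add_one_le_exp 1; norm_num at this; linarith
    calc ((2 : ℝ) ^ (N ! * (d * (τ + 1)))) ≤ (Real.exp 1) ^ (N ! * (d * (τ + 1))) :=
          pow_le_pow_left₀ (by norm_num) h2e _
      _ = Real.exp ((d : ℝ) * (τ + 1) * (N ! : ℕ)) := by
          rw [Real.exp_one_pow]; push_cast; ring_nf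
  have hL0' : 0 < L := by linarith
  have e : Cst * u * w = (2 * C₁ + τ + (d : ℝ) * (τ + 1) * A₀ + 1) * (u * w) ^ 1 := by
    rw [hCstdef, pow_one, mul_assoc]
  rw [e]
  exact two_mul_prod_le_exp hC₁pos hL0' hLuw huw1 le_rfl
    (by positivity) hA₀0 (by positivity) hqpow hNfact

end Engine

end Summit.Schanuel.Schanuel.Theorems.RootDecomp1KSkelCell
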